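import Summits.ResolutionOfSingularities.ResolutionOfSingularities.Theorems.EquisingularLiftEquisingularLiftNatUltFlat
import HarnessLib

/-!
# [OURS · L1 W4.5(b) · EL♮] A USEFUL TOUCH EXISTS: EL♮ ⇒ some admissible centre passes through a NON-REGULAR point over `x`
# and its blow-up leaves the reduced strict transform REGULAR AT EVERY POINT OVER `x` — any `n`
# (crux `EquisingularLiftNat` = stmt-ResolutionOfSingularities-20038; object T-USEFUL-TOUCH)

HONEST FRAMING. OURS (cell res-hironaka, crux chain w45b, slot W4.5(b)); NOT a statement of any manuscript; replaces the role
of NOTHING in the manuscript; AI-written, AI review is weaker than expert review. Helper `--supports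
stmt-ResolutionOfSingularities-20038 --as helper` (any-`n` object), necessity / K-∀n lane (disprover target of record n = 5,
hand res-D-brk-4; also the n = 3 level-0 analysis of res-L1-w45b-lead-2 LEAD-MEMO-1 §3 «(M) USEFUL ⟺ sheet-tangent»).

WHY. The typed necessary conditions `ULTAt` (res-L1-type-o1) / `ULTFlatAt` (p512565) record that SOME admissible centre
TOUCHES a point over `x` — nothing about the effect of the blow-up. But a successful chain has a LAST centre meeting the fibre
over `x`; every later step avoids that fibre and is an isomorphism near it (`nonregular_point_persists`, p500156), so the
regularity of the end over `x` is already achieved right after the last touch: THE LAST TOUCH IS USEFUL — its blow-up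
finishes the resolution over `x`. Useless touches (centres whose blow-up is an isomorphism on the strict transform near the
fibre over `x`: complete intersections with `H`, non-sheet-tangent multiples, …) therefore never suffice on their own.

* `exists_useful_touch_of_natChain` — general base (as p511287): typed chain + irreducible last special fibre + regular end
  + a non-regular point of `V(closure Y)` over `x ∈ Y` ⇒ a stage `(X₁, σ₁, Y₁)` in the HORIZONTAL closure (earlier touches
  over `x` allowed), a point `x₁ ∈ Y₁` over `x` NON-REGULAR in `V(closure Y₁)`, and an admissible step `τ : X₂ = Bl_C X₁ →
  X₁` (`V(C)` regular, `O`-FLAT, E1, non-generic) with `x₁ ∈ supp C` after which `V(closure Y₂)` is regular at every point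
  over `x`.
* `usefulTouch_of_equisingularLiftNat` — THE OBJECT for the item's ambient `ℙⁿ_O` (binders of `ULTFlat`, p512565):
  `EquisingularLiftNat p ⇒` for every non-regular `h`, over the item's `(O, π)` and every `φ, Y`, a useful touch over
  `x := (ι ≫ Proj.map φ) h`.
* `not_equisingularLiftNat_of_no_usefulTouch` — the disprover's exit in this currency.

References: tree files `…NatUltFlat` (p511287), `…NatUltOfNat` (p505870), `…NatHorizontalForced` (p509967),
`…NatFirstTouch` (p500156: `nonregular_point_persists`), `…NatVerticalCentre` (p504712), `…NatSpecialFibreMaxPoints`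
(p503337), `Literature…ComponentGluing` (`range_subschemeι_vanishingIdeal`); GW I Prop. 13.91 [GortzWedhorn2020].
-/

set_option linter.dupNamespace false -- mandated namespace `Summit.<Summit>.<Problem>` of this single-conjunct summit
set_option linter.overlappingInstances false -- item signatures carry `[IsDomain O] [IsDiscreteValuationRing O]`

open CategoryTheory AlgebraicGeometry TopologicalSpace Topology
open Literature.AlgebraicGeometry.Resolution
open AlgebraicGeometry.Scheme.IdealSheafData
open Summit.ResolutionOfSingularities.ResolutionOfSingularities.Theses.EquisingularLift.Split
open Summit.ResolutionOfSingularities.ResolutionOfSingularities.Cruxes.EquisingularLift.StrataSplit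
open Summit.ResolutionOfSingularities.ResolutionOfSingularities.Theorems.EquisingularLift

namespace Summit.ResolutionOfSingularities.ResolutionOfSingularities.Cruxes.EquisingularLiftNat.Sections

/-! ## A USEFUL TOUCH exists (general base) -/

/-- **A USEFUL TOUCH EXISTS (general base).** Setting of `exists_flat_touching_centre_of_natChain` (p511287): `O` a DVR, `P`
integral Noetherian over `q : P → Spec O` with generic point off the special fibre, `Y` inside the special fibre and off its
maximal points, `(P′, σ, S′)` in the item's E1-closure of `(P, 𝟙, Y)` with irreducible last special fibre and REGULAR
`V(closure S′)`, and `x ∈ Y` with a non-regular point of `V(closure Y)` over it. Then SOME step of the chain is a USEFUL TOUCH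
over `x`: there are a stage `(X₁, σ₁, Y₁)` in the HORIZONTAL closure of `(P, 𝟙, Y)` (all centres so far `O`-flat; earlier
touches over `x` allowed), a point `x₁ ∈ Y₁` over `x` at which `V(closure Y₁)` is NOT regular, and an admissible step
`τ : X₂ = Bl_C X₁ → X₁` — `V(C)` regular, `V(C) → Spec O` FLAT, `σ₁(supp C)` off the generic points of `Y`, E1 — whose centre
passes THROUGH `x₁` and after which `V(closure Y₂)` (`Y₂ = closure τ⁻¹(Y₁ ∖ supp C)`; stated with `closure (closure ·)`,
cf. `closure_closure`) is REGULAR AT EVERY POINT OVER `x`. (After the last centre meeting the fibre over `x` all later steps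
are isomorphisms near that fibre, `nonregular_point_persists` p500156, so the last touching blow-up finishes the resolution
over `x`.) Motive: invariants ∧ (GOAL ∨ two maximal points ∨ (horizontally reachable ∧ a non-regular point over `x`
survives)); flatness of the centre from p504712 + p509967 when both special fibres are irreducible. [folklore; GW I 13.91] -/
theorem exists_useful_touch_of_natChain {O : Type} [CommRing O] [IsDomain O] [IsDiscreteValuationRing O]
    {P : AlgebraicGeometry.Scheme.{0}} [AlgebraicGeometry.IsIntegral P] [AlgebraicGeometry.IsLocallyNoetherian P]
    [CompactSpace P] (q : P ⟶ AlgebraicGeometry.Spec (.of O)) (Y : Set P) {P' : AlgebraicGeometry.Scheme.{0}}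
    (σ : P' ⟶ P) (S' : Set P')
    (hch : (∀ Q : (∀ X' : AlgebraicGeometry.Scheme.{0}, (X' ⟶ P) → Set X' → Prop), Q P (CategoryTheory.CategoryStruct.id _) Y → (∀ (X' X'' : AlgebraicGeometry.Scheme.{0}) (σ' : X' ⟶ P) (Y' : Set X') (C : X'.IdealSheafData) (τ : X'' ⟶ X'), Q X' σ' Y' → Literature.AlgebraicGeometry.Resolution.IsBlowup τ C → Literature.AlgebraicGeometry.Resolution.Scheme.IsRegular C.subscheme → σ' '' (C.support : Set X') ⊆ {x | ¬ IsGenericPoint x Y} → (C.support : Set X') ∩ (CategoryTheory.CategoryStruct.comp σ' q) ⁻¹' {IsLocalRing.closedPoint O} ⊆ Y' → Q X'' (CategoryTheory.CategoryStruct.comp τ σ') (closure (τ ⁻¹' (Y' \ (C.support : Set X'))))) → Q P' σ S'))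
    (hirr : IsIrreducible ((CategoryTheory.CategoryStruct.comp σ q) ⁻¹' {IsLocalRing.closedPoint O}))
    (hreg : Literature.AlgebraicGeometry.Resolution.Scheme.IsRegular (AlgebraicGeometry.Scheme.IdealSheafData.vanishingIdeal (⟨closure S', isClosed_closure⟩ : TopologicalSpace.Closeds P')).subscheme)
    (hgenP : ∀ ξ : P, IsGenericPoint ξ (Set.univ : Set P) → ξ ∉ q ⁻¹' {IsLocalRing.closedPoint O})
    (hYF : Y ⊆ q ⁻¹' {IsLocalRing.closedPoint O})
    (hNM : ∀ w : P, (w ∈ q ⁻¹' {IsLocalRing.closedPoint O} ∧ ∀ y ∈ q ⁻¹' {IsLocalRing.closedPoint O}, y ⤳ w → y = w) →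
      w ∉ closure Y)
    {x : P} (hxY : x ∈ Y) (hx : (∃ w : ↥(AlgebraicGeometry.Scheme.IdealSheafData.vanishingIdeal (⟨closure Y, isClosed_closure⟩ : TopologicalSpace.Closeds P)).subscheme, (AlgebraicGeometry.Scheme.IdealSheafData.vanishingIdeal (⟨closure Y, isClosed_closure⟩ : TopologicalSpace.Closeds P)).subschemeι w = x ∧ ¬ IsRegularLocalRing ((AlgebraicGeometry.Scheme.IdealSheafData.vanishingIdeal (⟨closure Y, isClosed_closure⟩ : TopologicalSpace.Closeds P)).subscheme.presheaf.stalk w))) :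
    ∃ (X₁ : AlgebraicGeometry.Scheme.{0}) (σ₁ : X₁ ⟶ P) (Y₁ : Set X₁), (∀ Q : (∀ X' : AlgebraicGeometry.Scheme.{0}, (X' ⟶ P) → Set X' → Prop), Q P (CategoryTheory.CategoryStruct.id _) Y → (∀ (X' X'' : AlgebraicGeometry.Scheme.{0}) (σ' : X' ⟶ P) (Y' : Set X') (C : X'.IdealSheafData) (τ : X'' ⟶ X'), Q X' σ' Y' → Literature.AlgebraicGeometry.Resolution.IsBlowup τ C → Literature.AlgebraicGeometry.Resolution.Scheme.IsRegular C.subscheme → AlgebraicGeometry.Flat (CategoryTheory.CategoryStruct.comp C.subschemeι (CategoryTheory.CategoryStruct.comp σ' q)) → σ' '' (C.support : Set X') ⊆ {x | ¬ IsGenericPoint x Y} → (C.support : Set X') ∩ (CategoryTheory.CategoryStruct.comp σ' q) ⁻¹' {IsLocalRing.closedPoint O} ⊆ Y' → Q X'' (CategoryTheory.CategoryStruct.comp τ σ') (closure (τ ⁻¹' (Y' \ (C.support : Set X'))))) → Q X₁ σ₁ Y₁) ∧ ∃ x₁ : X₁, x₁ ∈ Y₁ ∧ σ₁ x₁ = x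 ∧ (∃ w : ↥(AlgebraicGeometry.Scheme.IdealSheafData.vanishingIdeal (⟨closure Y₁, isClosed_closure⟩ : TopologicalSpace.Closeds X₁)).subscheme, (AlgebraicGeometry.Scheme.IdealSheafData.vanishingIdeal (⟨closure Y₁, isClosed_closure⟩ : TopologicalSpace.Closeds X₁)).subschemeι w = x₁ ∧ ¬ IsRegularLocalRing ((AlgebraicGeometry.Scheme.IdealSheafData.vanishingIdeal (⟨closure Y₁, isClosed_closure⟩ : TopologicalSpace.Closeds X₁)).subscheme.presheaf.stalk w)) ∧ ∃ (C : X₁.IdealSheafData) (X₂ : AlgebraicGeometry.Scheme.{0}) (τ : X₂ ⟶ X₁), Literature.AlgebraicGeometry.Resolution.IsBlowup τ C ∧ Literature.AlgebraicGeometry.Resolution.Scheme.IsRegular C.subscheme ∧ AlgebraicGeometry.Flat (CategoryTheory.CategoryStruct.comp C.subschemeι (CategoryTheory.CategoryStruct.comp σ₁ q)) ∧ σ₁ '' (C.support : Set X₁) ⊆ {x | ¬ IsGenericPoint x Y} ∧ (C.support : Set X₁) ∩ (CategoryTheory.CategoryStruct.comp σ₁ q) ⁻¹' {IsLocalRing.closedPoint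 O} ⊆ Y₁ ∧ x₁ ∈ (C.support : Set X₁) ∧ (∀ w : ↥(AlgebraicGeometry.Scheme.IdealSheafData.vanishingIdeal (⟨closure (closure (τ ⁻¹' (Y₁ \ (C.support : Set X₁)))), isClosed_closure⟩ : TopologicalSpace.Closeds X₂)).subscheme, (CategoryTheory.CategoryStruct.comp τ σ₁) ((AlgebraicGeometry.Scheme.IdealSheafData.vanishingIdeal (⟨closure (closure (τ ⁻¹' (Y₁ \ (C.support : Set X₁)))), isClosed_closure⟩ : TopologicalSpace.Closeds X₂)).subschemeι w) = x → IsRegularLocalRing ((AlgebraicGeometry.Scheme.IdealSheafData.vanishingIdeal (⟨closure (closure (τ ⁻¹' (Y₁ \ (C.support : Set X₁)))), isClosed_closure⟩ : TopologicalSpace.Closeds X₂)).subscheme.presheaf.stalk w)) := by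
  -- local abbreviations
  let F : ∀ X' : Scheme.{0}, (X' ⟶ P) → Set X' := fun X' σ' =>
    (CategoryTheory.CategoryStruct.comp σ' q) ⁻¹' {IsLocalRing.closedPoint O}
  let MP : ∀ X' : Scheme.{0}, Set X' → X' → Prop := fun X' F w => w ∈ F ∧ ∀ y ∈ F, y ⤳ w → y = w
  let RED : ∀ X' : Scheme.{0}, (X' ⟶ P) → Prop := fun X' σ' =>
    ∃ w₁ w₂ : X', MP X' (F X' σ') w₁ ∧ MP X' (F X' σ') w₂ ∧ w₁ ≠ w₂
  let NM : ∀ X' : Scheme.{0}, (X' ⟶ P) → Set X' → Prop := fun X' σ' Y' =>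
    ∀ w : X', MP X' (F X' σ') w → w ∉ closure Y'
  let HR : ∀ X' : Scheme.{0}, (X' ⟶ P) → Set X' → Prop := fun X₁ σ₁ Y₁ =>
    (∀ Q : (∀ X' : AlgebraicGeometry.Scheme.{0}, (X' ⟶ P) → Set X' → Prop), Q P (CategoryTheory.CategoryStruct.id _) Y → (∀ (X' X'' : AlgebraicGeometry.Scheme.{0}) (σ' : X' ⟶ P) (Y' : Set X') (C : X'.IdealSheafData) (τ : X'' ⟶ X'), Q X' σ' Y' → Literature.AlgebraicGeometry.Resolution.IsBlowup τ C → Literature.AlgebraicGeometry.Resolution.Scheme.IsRegular C.subscheme → AlgebraicGeometry.Flat (CategoryTheory.CategoryStruct.comp C.subschemeι (CategoryTheory.CategoryStruct.comp σ' q)) → σ' '' (C.support : Set X') ⊆ {x | ¬ IsGenericPoint x Y} → (C.support : Set X') ∩ (CategoryTheory.CategoryStruct.comp σ' q) ⁻¹' {IsLocalRing.closedPoint O} ⊆ Y' → Q X'' (CategoryTheory.CategoryStruct.comp τ σ') (closure (τ ⁻¹' (Y' \ (C.support : Set X'))))) → Q X₁ σ₁ Y₁)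
  let NR : ∀ X' : Scheme.{0}, (X' ⟶ P) → Set X' → Prop := fun X' σ' Y' =>
    ∃ x' : X', x' ∈ Y' ∧ σ' x' = x ∧ (∃ w : ↥(AlgebraicGeometry.Scheme.IdealSheafData.vanishingIdeal (⟨closure Y', isClosed_closure⟩ : TopologicalSpace.Closeds X')).subscheme, (AlgebraicGeometry.Scheme.IdealSheafData.vanishingIdeal (⟨closure Y', isClosed_closure⟩ : TopologicalSpace.Closeds X')).subschemeι w = x' ∧ ¬ IsRegularLocalRing ((AlgebraicGeometry.Scheme.IdealSheafData.vanishingIdeal (⟨closure Y', isClosed_closure⟩ : TopologicalSpace.Closeds X')).subscheme.presheaf.stalk w))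
  have hFcl : ∀ (X' : Scheme.{0}) (σ' : X' ⟶ P), IsClosed (F X' σ') := fun X' σ' =>
    (IsLocalRing.isClosed_singleton_closedPoint O).preimage (CategoryTheory.CategoryStruct.comp σ' q).base.hom.continuous
  have hFstep : ∀ (X' X'' : Scheme.{0}) (σ' : X' ⟶ P) (τ : X'' ⟶ X'),
      F X'' (CategoryTheory.CategoryStruct.comp τ σ') = τ ⁻¹' F X' σ' := by
    intro X' X'' σ' τ
    ext v
    simp only [F, Set.mem_preimage, Scheme.Hom.comp_apply]
  -- run the E1-closure
  have key := hch (fun X' σ' Y' => ((IsLocallyNoetherian X' ∧ CompactSpace X') ∧ IsIntegral X' ∧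
      (∀ ξ : X', IsGenericPoint ξ (Set.univ : Set X') → ξ ∉ F X' σ') ∧ (F X' σ').Nonempty ∧ Y' ⊆ F X' σ' ∧
      NM X' σ' Y') ∧
      ((∃ (X₁ : AlgebraicGeometry.Scheme.{0}) (σ₁ : X₁ ⟶ P) (Y₁ : Set X₁), (∀ Q : (∀ X' : AlgebraicGeometry.Scheme.{0}, (X' ⟶ P) → Set X' → Prop), Q P (CategoryTheory.CategoryStruct.id _) Y → (∀ (X' X'' : AlgebraicGeometry.Scheme.{0}) (σ' : X' ⟶ P) (Y' : Set X') (C : X'.IdealSheafData) (τ : X'' ⟶ X'), Q X' σ' Y' → Literature.AlgebraicGeometry.Resolution.IsBlowup τ C → Literature.AlgebraicGeometry.Resolution.Scheme.IsRegular C.subscheme → AlgebraicGeometry.Flat (CategoryTheory.CategoryStruct.comp C.subschemeι (CategoryTheory.CategoryStruct.comp σ' q)) → σ' '' (C.support : Set X') ⊆ {x | ¬ IsGenericPoint x Y} → (C.support : Set X') ∩ (CategoryTheory.CategoryStruct.comp σ' q) ⁻¹' {IsLocalRing.closedPoint O} ⊆ Y' → Q X'' (CategoryTheory.CategoryStruct.comp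 τ σ') (closure (τ ⁻¹' (Y' \ (C.support : Set X'))))) → Q X₁ σ₁ Y₁) ∧ ∃ x₁ : X₁, x₁ ∈ Y₁ ∧ σ₁ x₁ = x ∧ (∃ w : ↥(AlgebraicGeometry.Scheme.IdealSheafData.vanishingIdeal (⟨closure Y₁, isClosed_closure⟩ : TopologicalSpace.Closeds X₁)).subscheme, (AlgebraicGeometry.Scheme.IdealSheafData.vanishingIdeal (⟨closure Y₁, isClosed_closure⟩ : TopologicalSpace.Closeds X₁)).subschemeι w = x₁ ∧ ¬ IsRegularLocalRing ((AlgebraicGeometry.Scheme.IdealSheafData.vanishingIdeal (⟨closure Y₁, isClosed_closure⟩ : TopologicalSpace.Closeds X₁)).subscheme.presheaf.stalk w)) ∧ ∃ (C : X₁.IdealSheafData) (X₂ : AlgebraicGeometry.Scheme.{0}) (τ : X₂ ⟶ X₁), Literature.AlgebraicGeometry.Resolution.IsBlowup τ C ∧ Literature.AlgebraicGeometry.Resolution.Scheme.IsRegular C.subscheme ∧ AlgebraicGeometry.Flat (CategoryTheory.CategoryStruct.comp C.subschemeι (CategoryTheory.CategoryStruct.comp σ₁ q)) ∧ σ₁ ''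 (C.support : Set X₁) ⊆ {x | ¬ IsGenericPoint x Y} ∧ (C.support : Set X₁) ∩ (CategoryTheory.CategoryStruct.comp σ₁ q) ⁻¹' {IsLocalRing.closedPoint O} ⊆ Y₁ ∧ x₁ ∈ (C.support : Set X₁) ∧ (∀ w : ↥(AlgebraicGeometry.Scheme.IdealSheafData.vanishingIdeal (⟨closure (closure (τ ⁻¹' (Y₁ \ (C.support : Set X₁)))), isClosed_closure⟩ : TopologicalSpace.Closeds X₂)).subscheme, (CategoryTheory.CategoryStruct.comp τ σ₁) ((AlgebraicGeometry.Scheme.IdealSheafData.vanishingIdeal (⟨closure (closure (τ ⁻¹' (Y₁ \ (C.support : Set X₁)))), isClosed_closure⟩ : TopologicalSpace.Closeds X₂)).subschemeι w) = x → IsRegularLocalRing ((AlgebraicGeometry.Scheme.IdealSheafData.vanishingIdeal (⟨closure (closure (τ ⁻¹' (Y₁ \ (C.support : Set X₁)))), isClosed_closure⟩ : TopologicalSpace.Closeds X₂)).subscheme.presheaf.stalk w))) ∨ RED X' σ' ∨ (HR X' σ' Y' ∧ NR X' σ' Y'))) ?_ ?_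
  · obtain ⟨-, hG | hred | ⟨-, x', -, -, w, -, hw⟩⟩ := key
    · exact hG
    · obtain ⟨w₁, w₂, hw₁, hw₂, hne⟩ := hred
      exact absurd (maxPt_unique_of_isIrreducible hirr (hFcl P' σ) hw₁ hw₂) hne
    · exact absurd (hreg w) hw
  · -- base
    refine ⟨⟨⟨inferInstance, inferInstance⟩, inferInstance, ?_, ?_, ?_, ?_⟩,
      Or.inr (Or.inr ⟨fun Q h0 _ => h0, x, hxY, by simp, hx⟩)⟩
    · simpa [F] using hgenP
    · exact ⟨x, by simpa [F] using hYF hxY⟩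
    · simpa [F] using hYF
    · simpa [NM, MP, F] using hNM
  · intro X' X'' σ' Y' C τ hQ hbl hC hgen hE1
    obtain ⟨⟨⟨hN', hc'⟩, hint, hgen', hne', hSF, hnm⟩, hQ⟩ := hQ
    haveI := hN'
    haveI := hc'
    haveI := hint
    haveI : IsProper τ := hbl.isProper
    haveI : IsLocallyNoetherian X'' := LocallyOfFiniteType.isLocallyNoetherian τ
    haveI : CompactSpace X'' := QuasiCompact.compactSpace_of_compactSpace τ
    haveI : AlgebraicGeometry.IsNoetherian X'' := AlgebraicGeometry.IsNoetherian.mk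
    have hF'' : F X'' (CategoryTheory.CategoryStruct.comp τ σ') = τ ⁻¹' F X' σ' := hFstep X' X'' σ' τ
    -- maximal points of the special fibre are off the centre
    have hNMC : ∀ w, MP X' (F X' σ') w → w ∉ (C.support : Set X') := fun w hw hwC =>
      hnm w hw (subset_closure (hE1 ⟨hwC, hw.1⟩))
    -- the centre is a genuine ideal sheaf
    have hC0 : C ≠ ⊥ := by
      rintro rfl
      obtain ⟨v, hv⟩ := hne'
      obtain ⟨m, hm, -⟩ := exists_maxPt_specializes (hFcl X' σ') hv
      apply hNMC m hm
      rw [Scheme.IdealSheafData.support_bot]; trivial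
    haveI : IsIntegral X'' := hbl.isIntegral hC0
    have hsurj : Function.Surjective τ := surjective_of_isBlowup hbl hC0
    -- persistence of the structural invariants
    have hgenX' : genericPoint X' ∉ F X' σ' := hgen' _ (genericPoint_spec X')
    have hgen'' : ∀ ξ : X'', IsGenericPoint ξ (Set.univ : Set X'') →
        ξ ∉ F X'' (CategoryTheory.CategoryStruct.comp τ σ') := by
      intro ξ hξ
      rw [hF'']
      have hτξ : IsGenericPoint (τ ξ) (Set.univ : Set X') := by
        have h1 := hξ.image τ.base.hom.continuous
        rwa [Set.image_univ, hsurj.range_eq, closure_univ] at h1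
      show τ ξ ∉ F X' σ'
      exact hgen' _ hτξ
    have hne'' : (F X'' (CategoryTheory.CategoryStruct.comp τ σ')).Nonempty := by
      obtain ⟨v, hv⟩ := hne'
      obtain ⟨m, hm, -⟩ := exists_maxPt_specializes (hFcl X' σ') hv
      obtain ⟨m'', hm'', -, -⟩ := exists_maxPt_preimage_of_step τ C hbl (F X' σ') hm (hNMC m hm)
      exact ⟨m'', by rw [hF'']; show τ m'' ∈ F X' σ'; rw [hm'']; exact hm.1⟩
    have hSF'' : closure (τ ⁻¹' (Y' \ (C.support : Set X'))) ⊆ F X'' (CategoryTheory.CategoryStruct.comp τ σ') := by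
      rw [hF'']
      exact closure_minimal (fun v ⟨hv, _⟩ => hSF hv) ((hFcl X' σ').preimage τ.base.hom.continuous)
    have hnm'' : NM X'' (CategoryTheory.CategoryStruct.comp τ σ') (closure (τ ⁻¹' (Y' \ (C.support : Set X')))) := by
      intro w hw
      rw [hF''] at hw
      exact maxPt_not_mem_strictTransform_of_step τ C hbl (F X' σ') (hFcl X' σ') Y' hSF hnm w hw
    have hredstep : RED X' σ' → RED X'' (CategoryTheory.CategoryStruct.comp τ σ') := by
      intro hred
      obtain ⟨v₁, v₂, hv₁, hv₂, hne⟩ := exists_two_maxPt_preimage_of_step τ C hbl (F X' σ') hNMC hred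
      refine ⟨v₁, v₂, ?_, ?_, hne⟩
      · rw [hF'']; exact hv₁
      · rw [hF'']; exact hv₂
    refine ⟨⟨⟨inferInstance, inferInstance⟩, inferInstance, hgen'', hne'', hSF'', hnm''⟩, ?_⟩
    rcases hQ with hG | hred | ⟨hhr, x', hx'Y, hx'x, w, hw, hwreg⟩
    · exact Or.inl hG
    · exact Or.inr (Or.inl (hredstep hred))
    · by_cases hred : RED X' σ' ∨ RED X'' (CategoryTheory.CategoryStruct.comp τ σ')
      · rcases hred with h | h
        · exact Or.inr (Or.inl (hredstep h))
        · exact Or.inr (Or.inl h)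
      · -- both special fibres are irreducible: the centre is horizontal everywhere, hence `O`-flat
        push Not at hred
        obtain ⟨hred', hred''⟩ := hred
        have huniq' : ∀ w₁ w₂, MP X' (F X' σ') w₁ → MP X' (F X' σ') w₂ → w₁ = w₂ := by
          intro w₁ w₂ h₁ h₂; by_contra hne; exact hred' ⟨w₁, w₂, h₁, h₂, hne⟩
        have huniq'' : ∀ w₁ w₂, MP X'' (F X'' (CategoryTheory.CategoryStruct.comp τ σ')) w₁ →
            MP X'' (F X'' (CategoryTheory.CategoryStruct.comp τ σ')) w₂ → w₁ = w₂ := by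
          intro w₁ w₂ h₁ h₂; by_contra hne; exact hred'' ⟨w₁, w₂, h₁, h₂, hne⟩
        have hirr' : IsIrreducible (F X' σ') := isIrreducible_of_maxPt_unique (hFcl X' σ') hne' huniq'
        have hirr'' : IsIrreducible (τ ⁻¹' F X' σ') := by
          rw [← hF'']
          exact isIrreducible_of_maxPt_unique (hFcl X'' _) hne'' huniq''
        obtain ⟨ζ, hζ⟩ := QuasiSober.sober hirr' (hFcl X' σ')
        have hζmax : MP X' (F X' σ') ζ := ⟨hζ.mem, fun y hy hyζ => ((hζ.specializes hy).antisymm hyζ).eq.symm⟩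
        have hζC : ζ ∉ (C.support : Set X') := hNMC ζ hζmax
        have hhor : ∀ x₀ ∈ (C.support : Set X'), ∃ c ∈ (C.support : Set X'), c ∉ F X' σ' ∧ c ⤳ x₀ :=
          fun x₀ hx₀ => exists_horizontal_generization_of_isIrreducible τ C hbl hC0 (F X' σ') (hFcl X' σ') hgenX' hζ
            hζC hirr'' hx₀
        have hflat : AlgebraicGeometry.Flat (CategoryTheory.CategoryStruct.comp C.subschemeι
            (CategoryTheory.CategoryStruct.comp σ' q)) :=
          flat_subschemeι_comp_of_horizontal (CategoryTheory.CategoryStruct.comp σ' q) C hC hhor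
        have hhr'' : HR X'' (CategoryTheory.CategoryStruct.comp τ σ') (closure (τ ⁻¹' (Y' \ (C.support : Set X')))) :=
          fun Q h0 hs => hs X' X'' σ' Y' C τ (hhr Q h0 hs) hbl hC hflat hgen hE1
        by_cases hall : ∀ z : ↥(AlgebraicGeometry.Scheme.IdealSheafData.vanishingIdeal (⟨closure (closure (τ ⁻¹' (Y' \ (C.support : Set X')))), isClosed_closure⟩ : TopologicalSpace.Closeds X'')).subscheme, (CategoryTheory.CategoryStruct.comp τ σ') ((AlgebraicGeometry.Scheme.IdealSheafData.vanishingIdeal (⟨closure (closure (τ ⁻¹' (Y' \ (C.support : Set X')))), isClosed_closure⟩ : TopologicalSpace.Closeds X'')).subschemeι z) = x → IsRegularLocalRing ((AlgebraicGeometry.Scheme.IdealSheafData.vanishingIdeal (⟨closure (closure (τ ⁻¹' (Y' \ (C.support : Set X')))), isClosed_closure⟩ : TopologicalSpace.Closeds X'')).subscheme.presheaf.stalk z)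
        · -- USEFUL TOUCH: every point over `x` is regular after this step; the surviving non-regular point lies in the centre
          have hx'C : x' ∈ (C.support : Set X') := by
            by_contra hx'C
            obtain ⟨x'', hx'', -, z, hz, hzreg⟩ := nonregular_point_persists τ C hbl Y' hx'Y hx'C w hw hwreg
            exact hzreg (hall z (by rw [hz, Scheme.Hom.comp_apply, hx'', hx'x]))
          exact Or.inl ⟨X', σ', Y', hhr, x', hx'Y, hx'x, ⟨w, hw, hwreg⟩, C, X'', τ, hbl, hC, hflat, hgen, hE1, hx'C, hall⟩
        · -- a non-regular point over `x` survives
          push Not at hall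
          obtain ⟨z, hzx, hzreg⟩ := hall
          refine Or.inr (Or.inr ⟨hhr'', _, ?_, hzx, z, rfl, hzreg⟩)
          have hz : (AlgebraicGeometry.Scheme.IdealSheafData.vanishingIdeal (⟨closure (closure (τ ⁻¹' (Y' \ (C.support : Set X')))), isClosed_closure⟩ : TopologicalSpace.Closeds X'')).subschemeι z ∈ closure (closure (τ ⁻¹' (Y' \ (C.support : Set X')))) := by
            have h := Set.mem_range_self (f := (AlgebraicGeometry.Scheme.IdealSheafData.vanishingIdeal (⟨closure (closure (τ ⁻¹' (Y' \ (C.support : Set X')))), isClosed_closure⟩ : TopologicalSpace.Closeds X'')).subschemeι) z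
            rw [ComponentGluing.range_subschemeι_vanishingIdeal] at h
            exact h
          exact Eq.subset closure_closure hz

/-! ## THE OBJECT: `EquisingularLiftNat p` ⇒ a useful touch over every non-regular point -/

/-- **[OURS · L1 W4.5(b)] `EquisingularLiftNat p` ⇒ A USEFUL TOUCH over every non-regular point.** If the item EL♮ holds at
`p`, then for every instance `(k, n, H, ι)`, every point `h` of `H` with non-regular local ring, the `O, π` the item provides
and every `φ, Y`, writing `x := (ι ≫ Proj.map φ) h`: there are a stage `(X₁, σ₁, Y₁)` in the HORIZONTAL E1-closure of
`(ℙⁿ_O, 𝟙, Y)`, a point `x₁ ∈ Y₁` over `x` at which `V(closure Y₁)` is NOT regular, and an admissible step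
`τ : X₂ = Bl_C X₁ → X₁` (`V(C)` regular and `O`-flat, `σ₁(supp C)` off the generic points of `Y`, E1) whose centre passes
THROUGH `x₁` and after which `V(closure Y₂)` is regular at EVERY point over `x`. Base facts for `ℙⁿ_O` as in
`ult_of_equisingularLiftNat` (p505870). [folklore] -/
theorem usefulTouch_of_equisingularLiftNat {p : ℕ}
    (hE : Summit.ResolutionOfSingularities.ResolutionOfSingularities.Theorems.EquisingularLiftNat p) :
    p.Prime → ∀ (k : Type) [Field k] [CharP k p] [IsAlgClosed k] (n : ℕ) (H : AlgebraicGeometry.Scheme.{0}) (ι : H ⟶ (Literature.AlgebraicGeometry.Motives.projectiveSpace n k).left), AlgebraicGeometry.IsClosedImmersion ι → AlgebraicGeometry.IsIntegral H → (∀ y : (Literature.AlgebraicGeometry.Motives.projectiveSpace n k).left, ∃ U : (Literature.AlgebraicGeometry.Motives.projectiveSpace n k).left.affineOpens, y ∈ (U : (Literature.AlgebraicGeometry.Motives.projectiveSpace n k).left.Opens) ∧ (ι.ker.ideal U).IsPrincipal) → ∀ (h : H), ¬ IsRegularLocalRing (H.presheaf.stalk h) → ∃ (O : Type) (_ : CommRing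 O) (_ : IsDomain O) (_ : IsDiscreteValuationRing O) (_ : CharZero O) (π : O →+* k), Function.Surjective π ∧ (letI := MvPolynomial.gradedAlgebra (σ := Fin (n + 1)) (R := O); letI := MvPolynomial.gradedAlgebra (σ := Fin (n + 1)) (R := k); ∀ (φ : MvPolynomial.homogeneousSubmodule (Fin (n + 1)) O →+*ᵍ MvPolynomial.homogeneousSubmodule (Fin (n + 1)) k) (hφ' : HomogeneousIdeal.irrelevant (MvPolynomial.homogeneousSubmodule (Fin (n + 1)) k) ≤ (HomogeneousIdeal.irrelevant (MvPolynomial.homogeneousSubmodule (Fin (n + 1)) O)).map φ), (∀ s, φ s = MvPolynomial.map π s) → ∀ Y : Set (AlgebraicGeometry.Proj (MvPolynomial.homogeneousSubmodule (Fin (n + 1)) O)), Y = Set.range (CategoryTheory.CategoryStruct.comp ι (AlgebraicGeometry.Proj.map φ hφ') : H ⟶ (AlgebraicGeometry.Proj (MvPolynomial.homogeneousSubmodule (Fin (n + 1)) O))) → ∃ (X₁ : AlgebraicGeometry.Scheme.{0}) (σ₁ : X₁ ⟶ (AlgebraicGeometry.Proj (MvPolynomial.homogeneousSubmodule (Fin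 (n + 1)) O))) (Y₁ : Set X₁), (∀ Q : (∀ X' : AlgebraicGeometry.Scheme.{0}, (X' ⟶ (AlgebraicGeometry.Proj (MvPolynomial.homogeneousSubmodule (Fin (n + 1)) O))) → Set X' → Prop), Q (AlgebraicGeometry.Proj (MvPolynomial.homogeneousSubmodule (Fin (n + 1)) O)) (CategoryTheory.CategoryStruct.id _) Y → (∀ (X' X'' : AlgebraicGeometry.Scheme.{0}) (σ' : X' ⟶ (AlgebraicGeometry.Proj (MvPolynomial.homogeneousSubmodule (Fin (n + 1)) O))) (Y' : Set X') (C : X'.IdealSheafData) (τ : X'' ⟶ X'), Q X' σ' Y' → Literature.AlgebraicGeometry.Resolution.IsBlowup τ C → Literature.AlgebraicGeometry.Resolution.Scheme.IsRegular C.subscheme → AlgebraicGeometry.Flat (CategoryTheory.CategoryStruct.comp C.subschemeι (CategoryTheory.CategoryStruct.comp σ' (CategoryTheory.CategoryStruct.comp (AlgebraicGeometry.Proj.toSpecZero (MvPolynomial.homogeneousSubmodule (Fin (n + 1)) O)) (AlgebraicGeometry.Spec.map (CommRingCat.ofHom (algebraMap O (MvPolynomial.homogeneousSubmodule (Fin (n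 + 1)) O 0))))))) → σ' '' (C.support : Set X') ⊆ {x | ¬ IsGenericPoint x Y} → (C.support : Set X') ∩ (CategoryTheory.CategoryStruct.comp σ' (CategoryTheory.CategoryStruct.comp (AlgebraicGeometry.Proj.toSpecZero (MvPolynomial.homogeneousSubmodule (Fin (n + 1)) O)) (AlgebraicGeometry.Spec.map (CommRingCat.ofHom (algebraMap O (MvPolynomial.homogeneousSubmodule (Fin (n + 1)) O 0)))))) ⁻¹' {IsLocalRing.closedPoint O} ⊆ Y' → Q X'' (CategoryTheory.CategoryStruct.comp τ σ') (closure (τ ⁻¹' (Y' \ (C.support : Set X'))))) → Q X₁ σ₁ Y₁) ∧ ∃ x₁ : X₁, x₁ ∈ Y₁ ∧ σ₁ x₁ = ((CategoryTheory.CategoryStruct.comp ι (AlgebraicGeometry.Proj.map φ hφ') : H ⟶ (AlgebraicGeometry.Proj (MvPolynomial.homogeneousSubmodule (Fin (n + 1)) O))) h) ∧ (∃ w : ↥(AlgebraicGeometry.Scheme.IdealSheafData.vanishingIdeal (⟨closure Y₁, isClosed_closure⟩ : TopologicalSpace.Closeds X₁)).subscheme, (AlgebraicGeometry.Scheme.IdealSheafData.vanishingIdeal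 (⟨closure Y₁, isClosed_closure⟩ : TopologicalSpace.Closeds X₁)).subschemeι w = x₁ ∧ ¬ IsRegularLocalRing ((AlgebraicGeometry.Scheme.IdealSheafData.vanishingIdeal (⟨closure Y₁, isClosed_closure⟩ : TopologicalSpace.Closeds X₁)).subscheme.presheaf.stalk w)) ∧ ∃ (C : X₁.IdealSheafData) (X₂ : AlgebraicGeometry.Scheme.{0}) (τ : X₂ ⟶ X₁), Literature.AlgebraicGeometry.Resolution.IsBlowup τ C ∧ Literature.AlgebraicGeometry.Resolution.Scheme.IsRegular C.subscheme ∧ AlgebraicGeometry.Flat (CategoryTheory.CategoryStruct.comp C.subschemeι (CategoryTheory.CategoryStruct.comp σ₁ (CategoryTheory.CategoryStruct.comp (AlgebraicGeometry.Proj.toSpecZero (MvPolynomial.homogeneousSubmodule (Fin (n + 1)) O)) (AlgebraicGeometry.Spec.map (CommRingCat.ofHom (algebraMap O (MvPolynomial.homogeneousSubmodule (Fin (n + 1)) O 0))))))) ∧ σ₁ '' (C.support : Set X₁) ⊆ {x | ¬ IsGenericPoint x Y} ∧ (C.support : Set X₁) ∩ (CategoryTheory.CategoryStruct.comp σ₁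 (CategoryTheory.CategoryStruct.comp (AlgebraicGeometry.Proj.toSpecZero (MvPolynomial.homogeneousSubmodule (Fin (n + 1)) O)) (AlgebraicGeometry.Spec.map (CommRingCat.ofHom (algebraMap O (MvPolynomial.homogeneousSubmodule (Fin (n + 1)) O 0)))))) ⁻¹' {IsLocalRing.closedPoint O} ⊆ Y₁ ∧ x₁ ∈ (C.support : Set X₁) ∧ (∀ w : ↥(AlgebraicGeometry.Scheme.IdealSheafData.vanishingIdeal (⟨closure (closure (τ ⁻¹' (Y₁ \ (C.support : Set X₁)))), isClosed_closure⟩ : TopologicalSpace.Closeds X₂)).subscheme, (CategoryTheory.CategoryStruct.comp τ σ₁) ((AlgebraicGeometry.Scheme.IdealSheafData.vanishingIdeal (⟨closure (closure (τ ⁻¹' (Y₁ \ (C.support : Set X₁)))), isClosed_closure⟩ : TopologicalSpace.Closeds X₂)).subschemeι w) = ((CategoryTheory.CategoryStruct.comp ι (AlgebraicGeometry.Proj.map φ hφ') : H ⟶ (AlgebraicGeometry.Proj (MvPolynomial.homogeneousSubmodule (Fin (n + 1)) O))) h) → IsRegularLocalRing ((AlgebraicGeometry.Scheme.IdealSheafData.vanishingIdeal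 (⟨closure (closure (τ ⁻¹' (Y₁ \ (C.support : Set X₁)))), isClosed_closure⟩ : TopologicalSpace.Closeds X₂)).subscheme.presheaf.stalk w))) := by
  intro hp k _ _ _ n H ι hι hH hloc h hreg
  obtain ⟨O, i1, i2, i3, i4, π, hπ, h'⟩ := hE hp k n H ι hι hH hloc
  refine ⟨O, i1, i2, i3, i4, π, hπ, ?_⟩
  letI := MvPolynomial.gradedAlgebra (σ := Fin (n + 1)) (R := O)
  letI := MvPolynomial.gradedAlgebra (σ := Fin (n + 1)) (R := k)
  intro φ hφ' hφ Y hY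
  haveI := hH
  obtain ⟨P', σ, S', hchain, hirr, hregS⟩ := h' φ hφ' hφ Y hY
  -- the base `q : ℙⁿ_O → Spec O`
  set q : Proj (MvPolynomial.homogeneousSubmodule (Fin (n + 1)) O) ⟶ Spec (.of O) :=
    Proj.toSpecZero (MvPolynomial.homogeneousSubmodule (Fin (n + 1)) O) ≫
      Spec.map (CommRingCat.ofHom (algebraMap O (MvPolynomial.homogeneousSubmodule (Fin (n + 1)) O 0))) with hq
  obtain ⟨hsm, hprop⟩ := stub_projectiveAmbientSmoothProper O n
  haveI : IsProper q := hprop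
  haveI : Smooth q := hsm
  haveI : IsNoetherianRing (CommRingCat.of O) := inferInstanceAs (IsNoetherianRing O)
  haveI : IsDomain (CommRingCat.of O) := inferInstanceAs (IsDomain O)
  haveI : IsLocallyNoetherian (Proj (MvPolynomial.homogeneousSubmodule (Fin (n + 1)) O)) :=
    LocallyOfFiniteType.isLocallyNoetherian q
  haveI : CompactSpace ↥(Proj (MvPolynomial.homogeneousSubmodule (Fin (n + 1)) O)) :=
    QuasiCompact.compactSpace_of_compactSpace q
  haveI : IsIntegral (Proj (MvPolynomial.homogeneousSubmodule (Fin (n + 1)) O)) :=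
    Proj.isIntegral _ (irrelevant_homogeneousSubmodule_ne_bot n O)
  -- the comparison `g : ℙⁿ_k → ℙⁿ_O`, a closed immersion onto the special fibre
  set g : Proj (MvPolynomial.homogeneousSubmodule (Fin (n + 1)) k) ⟶
      Proj (MvPolynomial.homogeneousSubmodule (Fin (n + 1)) O) := Proj.map φ hφ' with hg
  have hP := ProjectiveAmbientFibre.isPullback_projMap π φ hφ hπ hφ'
  haveI : IsClosedImmersion (Spec.map (CommRingCat.ofHom π)) := IsClosedImmersion.spec_of_surjective _ hπ
  haveI hgci : IsClosedImmersion g := MorphismProperty.IsStableUnderBaseChange.of_isPullback hP.flip inferInstance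
  have hpt : ∀ z : Spec (.of k), Spec.map (CommRingCat.ofHom π) z = IsLocalRing.closedPoint O := by
    intro z
    rw [Spec.map_apply]
    apply PrimeSpectrum.ext
    rw [PrimeSpectrum.comap_asIdeal, CommRingCat.hom_ofHom, Ideal.eq_bot_of_prime z.asIdeal, ← RingHom.ker_eq_comap_bot]
    exact IsLocalRing.eq_maximalIdeal (RingHom.ker_isMaximal_of_surjective π hπ)
  have hgq : ∀ z, q (g z) = IsLocalRing.closedPoint O := fun z ↦
    (Scheme.Hom.comp_apply g q z).symm.trans
      ((congrArg (fun h : Proj (MvPolynomial.homogeneousSubmodule (Fin (n + 1)) k) ⟶ Spec (.of O) ↦ h z) hP.w).trans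
        ((Scheme.Hom.comp_apply _ _ z).trans (hpt _)))
  -- `ι` as a closed immersion into `Proj k[x]`
  let ι' : H ⟶ Proj (MvPolynomial.homogeneousSubmodule (Fin (n + 1)) k) := ι
  haveI : IsClosedImmersion ι' := hι
  have hYF : Y ⊆ q ⁻¹' {IsLocalRing.closedPoint O} := by
    rw [hY]
    rintro _ ⟨a, rfl⟩
    show q ((ι ≫ g) a) = IsLocalRing.closedPoint O
    rw [Scheme.Hom.comp_apply]
    exact hgq (ι a)
  have hYcl : IsClosed Y := by rw [hY]; exact (ι' ≫ g).isClosedEmbedding.isClosed_range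
  -- a point of `ℙⁿ_k` outside `range ι` (else `H ≅ ℙⁿ_k` would be regular at `h`)
  have hH' : ∃ z : Proj (MvPolynomial.homogeneousSubmodule (Fin (n + 1)) k), z ∉ Set.range ι' := by
    by_contra hall
    push Not at hall
    have hrange : Set.range (𝟙 (Proj (MvPolynomial.homogeneousSubmodule (Fin (n + 1)) k))) = Set.range ι' := by
      ext z; simpa using hall z
    haveI : IsIntegral (Proj (MvPolynomial.homogeneousSubmodule (Fin (n + 1)) k)) :=
      isIntegral_proj_homogeneousSubmodule n k
    have hregP : IsRegularLocalRing ((Proj (MvPolynomial.homogeneousSubmodule (Fin (n + 1)) k)).presheaf.stalk (ι' h)) :=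
      isRegular_projectiveSpace n k (ι' h)
    exact hreg ((isRegularLocalRing_stalk_iff_of_range_eq (𝟙 _) ι' hrange (a₁ := ι' h) (a₂ := h) (by simp)).mpr hregP)
  -- no maximal point of the (irreducible) special fibre lies in `closure Y = Y`
  have hirrP : IsIrreducible (q ⁻¹' {IsLocalRing.closedPoint O}) := by
    haveI := isIntegral_specialFibre_projectiveSpace O n
    exact isIrreducible_preimage_closedPoint O _ q
  have hNM : ∀ w, (w ∈ q ⁻¹' {IsLocalRing.closedPoint O} ∧
      ∀ y ∈ q ⁻¹' {IsLocalRing.closedPoint O}, y ⤳ w → y = w) → w ∉ closure Y := by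
    intro w hw hwY
    obtain ⟨ζ, hζ⟩ := QuasiSober.sober hirrP
      ((IsLocalRing.isClosed_singleton_closedPoint O).preimage q.base.hom.continuous)
    have hζw : ζ = w := hw.2 ζ hζ.mem (hζ.specializes hw.1)
    rw [hYcl.closure_eq] at hwY
    have hFY : q ⁻¹' {IsLocalRing.closedPoint O} ⊆ Y := by
      rw [← hζ.def, hζw]
      exact closure_minimal (Set.singleton_subset_iff.mpr hwY) hYcl
    obtain ⟨z, hz⟩ := hH'
    have hgz : g z ∈ Y := hFY (hgq z)
    rw [hY] at hgz
    obtain ⟨a, ha⟩ := hgz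
    rw [Scheme.Hom.comp_apply] at ha
    exact hz ⟨a, g.isClosedEmbedding.injective ha⟩
  -- the generic point of `ℙⁿ_O` is off the special fibre
  have hgenP : ∀ ξ : Proj (MvPolynomial.homogeneousSubmodule (Fin (n + 1)) O),
      IsGenericPoint ξ (Set.univ : Set (Proj (MvPolynomial.homogeneousSubmodule (Fin (n + 1)) O))) →
        ξ ∉ q ⁻¹' {IsLocalRing.closedPoint O} := by
    intro ξ hξ hξF
    have hopen : IsOpen (Set.range q) := by
      rw [← Set.image_univ]; exact q.isOpenMap _ isOpen_univ
    have hne : (Set.range q).Nonempty := ⟨q ξ, ξ, rfl⟩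
    have hgen : genericPoint (Spec (.of O)) ∈ Set.range q := by
      rw [(genericPoint_spec (Spec (.of O))).mem_open_set_iff hopen]
      simpa using hne
    obtain ⟨p₀, hp₀⟩ := hgen
    have hp₀F : p₀ ∈ q ⁻¹' {IsLocalRing.closedPoint O} := by
      have hF : q ⁻¹' {IsLocalRing.closedPoint O} = Set.univ := by
        apply Set.eq_univ_of_univ_subset
        rw [← hξ.def]
        exact closure_minimal (Set.singleton_subset_iff.mpr hξF)
          ((IsLocalRing.isClosed_singleton_closedPoint O).preimage q.base.hom.continuous)
      rw [hF]; trivial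
    have h1 : genericPoint (Spec (.of O)) = IsLocalRing.closedPoint O := hp₀.symm.trans hp₀F
    rw [genericPoint_eq_bot_of_affine] at h1
    have h2 := congrArg PrimeSpectrum.asIdeal h1
    exact IsDiscreteValuationRing.not_a_field O h2.symm
  -- the non-regular point of `V(closure Y)` over `x := (ι ≫ g) h` (pv-003's bridge)
  have hci := @IsClosedImmersion.comp _ _ _ ι _ hι hgci
  have hx := @exists_vanishingIdeal_witness_of_not_isRegularLocalRing _ _ _ hci inferInstance _ hreg
  subst hY
  exact exists_useful_touch_of_natChain q _ σ S' hchain hirr hregS hgenP hYF hNM ⟨h, rfl⟩ hx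


/-- **The disprover's exit (useful-touch currency).** If for ONE instance and ONE non-regular `h`, for EVERY `(O, π)` some
`φ, Y` admit NO useful touch over `x` (the negation of the body above), then `EquisingularLiftNat p` fails. [folklore] -/
theorem not_equisingularLiftNat_of_no_usefulTouch {p : ℕ}
    (hno : ¬ (p.Prime → ∀ (k : Type) [Field k] [CharP k p] [IsAlgClosed k] (n : ℕ) (H : AlgebraicGeometry.Scheme.{0}) (ι : H ⟶ (Literature.AlgebraicGeometry.Motives.projectiveSpace n k).left), AlgebraicGeometry.IsClosedImmersion ι → AlgebraicGeometry.IsIntegral H → (∀ y : (Literature.AlgebraicGeometry.Motives.projectiveSpace n k).left, ∃ U : (Literature.AlgebraicGeometry.Motives.projectiveSpace n k).left.affineOpens, y ∈ (U : (Literature.AlgebraicGeometry.Motives.projectiveSpace n k).left.Opens) ∧ (ι.ker.ideal U).IsPrincipal) → ∀ (h : H), ¬ IsRegularLocalRing (H.presheaf.stalk h) → ∃ (O : Type) (_ : CommRing O) (_ : IsDomain O) (_ : IsDiscreteValuationRing O) (_ : CharZero O) (π : O →+* k), Function.Surjective π ∧ (letI := MvPolynomial.gradedAlgebra (σ := Fin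 (n + 1)) (R := O); letI := MvPolynomial.gradedAlgebra (σ := Fin (n + 1)) (R := k); ∀ (φ : MvPolynomial.homogeneousSubmodule (Fin (n + 1)) O →+*ᵍ MvPolynomial.homogeneousSubmodule (Fin (n + 1)) k) (hφ' : HomogeneousIdeal.irrelevant (MvPolynomial.homogeneousSubmodule (Fin (n + 1)) k) ≤ (HomogeneousIdeal.irrelevant (MvPolynomial.homogeneousSubmodule (Fin (n + 1)) O)).map φ), (∀ s, φ s = MvPolynomial.map π s) → ∀ Y : Set (AlgebraicGeometry.Proj (MvPolynomial.homogeneousSubmodule (Fin (n + 1)) O)), Y = Set.range (CategoryTheory.CategoryStruct.comp ι (AlgebraicGeometry.Proj.map φ hφ') : H ⟶ (AlgebraicGeometry.Proj (MvPolynomial.homogeneousSubmodule (Fin (n + 1)) O))) → ∃ (X₁ : AlgebraicGeometry.Scheme.{0}) (σ₁ : X₁ ⟶ (AlgebraicGeometry.Proj (MvPolynomial.homogeneousSubmodule (Fin (n + 1)) O))) (Y₁ : Set X₁), (∀ Q : (∀ X' : AlgebraicGeometry.Scheme.{0}, (X' ⟶ (AlgebraicGeometry.Proj (MvPolynomial.homogeneousSubmodule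 (Fin (n + 1)) O))) → Set X' → Prop), Q (AlgebraicGeometry.Proj (MvPolynomial.homogeneousSubmodule (Fin (n + 1)) O)) (CategoryTheory.CategoryStruct.id _) Y → (∀ (X' X'' : AlgebraicGeometry.Scheme.{0}) (σ' : X' ⟶ (AlgebraicGeometry.Proj (MvPolynomial.homogeneousSubmodule (Fin (n + 1)) O))) (Y' : Set X') (C : X'.IdealSheafData) (τ : X'' ⟶ X'), Q X' σ' Y' → Literature.AlgebraicGeometry.Resolution.IsBlowup τ C → Literature.AlgebraicGeometry.Resolution.Scheme.IsRegular C.subscheme → AlgebraicGeometry.Flat (CategoryTheory.CategoryStruct.comp C.subschemeι (CategoryTheory.CategoryStruct.comp σ' (CategoryTheory.CategoryStruct.comp (AlgebraicGeometry.Proj.toSpecZero (MvPolynomial.homogeneousSubmodule (Fin (n + 1)) O)) (AlgebraicGeometry.Spec.map (CommRingCat.ofHom (algebraMap O (MvPolynomial.homogeneousSubmodule (Fin (n + 1)) O 0))))))) → σ' '' (C.support : Set X') ⊆ {x | ¬ IsGenericPoint x Y} → (C.support : Set X') ∩ (CategoryTheory.CategoryStruct.comp σ' (CategoryTheory.CategoryStruct.comp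 (AlgebraicGeometry.Proj.toSpecZero (MvPolynomial.homogeneousSubmodule (Fin (n + 1)) O)) (AlgebraicGeometry.Spec.map (CommRingCat.ofHom (algebraMap O (MvPolynomial.homogeneousSubmodule (Fin (n + 1)) O 0)))))) ⁻¹' {IsLocalRing.closedPoint O} ⊆ Y' → Q X'' (CategoryTheory.CategoryStruct.comp τ σ') (closure (τ ⁻¹' (Y' \ (C.support : Set X'))))) → Q X₁ σ₁ Y₁) ∧ ∃ x₁ : X₁, x₁ ∈ Y₁ ∧ σ₁ x₁ = ((CategoryTheory.CategoryStruct.comp ι (AlgebraicGeometry.Proj.map φ hφ') : H ⟶ (AlgebraicGeometry.Proj (MvPolynomial.homogeneousSubmodule (Fin (n + 1)) O))) h) ∧ (∃ w : ↥(AlgebraicGeometry.Scheme.IdealSheafData.vanishingIdeal (⟨closure Y₁, isClosed_closure⟩ : TopologicalSpace.Closeds X₁)).subscheme, (AlgebraicGeometry.Scheme.IdealSheafData.vanishingIdeal (⟨closure Y₁, isClosed_closure⟩ : TopologicalSpace.Closeds X₁)).subschemeι w = x₁ ∧ ¬ IsRegularLocalRing ((AlgebraicGeometry.Scheme.IdealSheafData.vanishingIdeal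 (⟨closure Y₁, isClosed_closure⟩ : TopologicalSpace.Closeds X₁)).subscheme.presheaf.stalk w)) ∧ ∃ (C : X₁.IdealSheafData) (X₂ : AlgebraicGeometry.Scheme.{0}) (τ : X₂ ⟶ X₁), Literature.AlgebraicGeometry.Resolution.IsBlowup τ C ∧ Literature.AlgebraicGeometry.Resolution.Scheme.IsRegular C.subscheme ∧ AlgebraicGeometry.Flat (CategoryTheory.CategoryStruct.comp C.subschemeι (CategoryTheory.CategoryStruct.comp σ₁ (CategoryTheory.CategoryStruct.comp (AlgebraicGeometry.Proj.toSpecZero (MvPolynomial.homogeneousSubmodule (Fin (n + 1)) O)) (AlgebraicGeometry.Spec.map (CommRingCat.ofHom (algebraMap O (MvPolynomial.homogeneousSubmodule (Fin (n + 1)) O 0))))))) ∧ σ₁ '' (C.support : Set X₁) ⊆ {x | ¬ IsGenericPoint x Y} ∧ (C.support : Set X₁) ∩ (CategoryTheory.CategoryStruct.comp σ₁ (CategoryTheory.CategoryStruct.comp (AlgebraicGeometry.Proj.toSpecZero (MvPolynomial.homogeneousSubmodule (Fin (n + 1)) O)) (AlgebraicGeometry.Spec.map (CommRingCat.ofHom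 (algebraMap O (MvPolynomial.homogeneousSubmodule (Fin (n + 1)) O 0)))))) ⁻¹' {IsLocalRing.closedPoint O} ⊆ Y₁ ∧ x₁ ∈ (C.support : Set X₁) ∧ (∀ w : ↥(AlgebraicGeometry.Scheme.IdealSheafData.vanishingIdeal (⟨closure (closure (τ ⁻¹' (Y₁ \ (C.support : Set X₁)))), isClosed_closure⟩ : TopologicalSpace.Closeds X₂)).subscheme, (CategoryTheory.CategoryStruct.comp τ σ₁) ((AlgebraicGeometry.Scheme.IdealSheafData.vanishingIdeal (⟨closure (closure (τ ⁻¹' (Y₁ \ (C.support : Set X₁)))), isClosed_closure⟩ : TopologicalSpace.Closeds X₂)).subschemeι w) = ((CategoryTheory.CategoryStruct.comp ι (AlgebraicGeometry.Proj.map φ hφ') : H ⟶ (AlgebraicGeometry.Proj (MvPolynomial.homogeneousSubmodule (Fin (n + 1)) O))) h) → IsRegularLocalRing ((AlgebraicGeometry.Scheme.IdealSheafData.vanishingIdeal (⟨closure (closure (τ ⁻¹' (Y₁ \ (C.support : Set X₁)))), isClosed_closure⟩ : TopologicalSpace.Closeds X₂)).subscheme.presheaf.stalk w))))) :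
    ¬ Summit.ResolutionOfSingularities.ResolutionOfSingularities.Theorems.EquisingularLiftNat p :=
  fun hE => hno (usefulTouch_of_equisingularLiftNat hE)

end Summit.ResolutionOfSingularities.ResolutionOfSingularities.Cruxes.EquisingularLiftNat.Sections
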